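import Summits.NavierStokesRegularity.NavierStokesRegularity.Theorems.RungBlowupCofinal.SectoralReynoldsStress
import Summits.NavierStokesRegularity.NavierStokesRegularity.Theorems.RungBlowupCofinal.ConvectiveLiftLetters
import HarnessLib

/-!
# The REYNOLDS STRESS of the full sectoral three-lift wave `W = a∇φ + bφ·y + c y×∇φ`,
# `φ = Re(y₀+iy₁)ⁿ`, in closed form — the complete nonlinear forcing letter of the ZONAL equation
# in the sectoral `(L, L)` cell (route `AngularGalerkinLadder`, crux K1 `RungBlowupCofinal`;
# kinematic helper, theorems only)

Cell `ns-blowup`, seat `ns-blowup-circuit` (g12, AGL Lean seat). Helper file for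
`stmt-NavierStokesRegularity-19959`, line `Cruxes/RungBlowupCofinal/Lines/qlwave.lean`, card support
target **(S5)** (nonlinear lift letters). Continues `SectoralReynoldsStress.lean` (toroidal member
only) and `ConvectiveLiftLetters.lean` (product rules). For `n = m + 2`, `ℓ(y) = y₀ + iy₁`,
differentiable radial profiles `a, b, c` (values and derivatives `a′, b′, c′` taken at `‖y‖²`), the
sectoral three-profile wave `W = a∇Re ℓⁿ + b Re ℓⁿ · y + c y × ∇Re ℓⁿ` and its quadrature
companion `W'` (the same lift of `Im ℓⁿ`; `J₃W = nW'` by `SolidHarmonicPrecession`):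

  `(W·∇)W + (W'·∇)W' = s^{n−2} · [ F_r · (y₀, y₁, 0) + F_φ · (−y₁, y₀, 0) + F_z · e₃ ]`,
  `s = y₀² + y₁²`, `z = y₂`, `ρ = s + z² = ‖y‖²`,
  `F_r = 2n²(n−1)a² + 2n²s·aa′ + 3n²s·ab + 2ns²·ab′ + (n+1)s²·b² + 2nsρ·a′b + 2s²ρ·bb′`
        `+ n²(2(n−1)z² − s)·c²`,
  `F_φ = n z s · (2n·ac′ + (n+1)·bc + 2ρ·bc′)`,
  `F_z = z · (2n²s·ab + 2ns²·ab′ + (n+1)s²·b² + 2s²ρ·bb′ − 2n³s·c²)`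

(`sectoralThreeLift_selfAdvection_sum`; derived symbolically — HOME `circuit/agl/cas/sectoral_rs.py`
— and certified here by the kernel, `ring` on each coordinate). READING: the Reynolds stress of a
sectoral wave pair is ZONAL (a polynomial in `s, z` times the frame `(y₀,y₁,0), (−y₁,y₀,0), e₃`);
its SWIRL-forcing component `F_φ` — the streak source of the SSP dictionary — is present iff the
wave has BOTH a poloidal (`a` or `b`) and a toroidal (`c`) member, and is odd in `z` (vanishes on
the equatorial plane); a pure toroidal wave forces rolls only (`toroidalSectoral_selfAdvection_sum`,
recovered at `a = b = 0`), a pure poloidal wave (`c = 0`) forces no swirl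
(`sectoralThreeLift_swirlForcing`, `sectoralPoloidal_selfAdvection_swirl_free`). TECHNICAL: the
exponents are typed `^ (2 : ℕ)` in the long statements — with bare literals the default-instance
pass of the elaborator exceeds the heartbeat budget on a statement of this size.

LABEL: KERNEL kinematics. Nothing here asserts a Theses declaration; no definition, no named fact,
no sorry. WHAT THIS IS NOT: not Navier–Stokes evidence; not a profile; the zonal RESPONSE (the
radial boundary-value problem) and the band / co-band split of this forcing (isotypes `j ≤ 2n`
against the rung) are untouched. References: [cite: BullardGellman1954];
[cite: MajdaBertozziCUP2002, §1.1].
-/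

noncomputable section

namespace Summit.NavierStokesRegularity.AngularGalerkinLadderSectoralReynoldsStressFull

open Set Function Complex
open scoped ContDiff RealInnerProductSpace
open Literature.Analysis.FluidPDE
open Summit.NavierStokesRegularity.FluidComputer Summit.NavierStokesRegularity.FluidComputer.AngularLadder
open Summit.NavierStokesRegularity.AngularGalerkinLadderSectoralHarmonics
open Summit.NavierStokesRegularity.AngularGalerkinLadderSectoralReynoldsStress
open Summit.NavierStokesRegularity.AngularGalerkinLadderConvectiveLiftLetters

variable (ℓ : EuclideanSpace ℝ (Fin 3) →L[ℝ] ℂ)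

/-! ## §1 Coordinates and the assembled product rule -/

/-- The real inner product on `ℝ³` in coordinates. [folklore] -/
private theorem inner_fin3 (v w : EuclideanSpace ℝ (Fin 3)) :
    ⟪v, w⟫ = v 0 * w 0 + v 1 * w 1 + v 2 * w 2 := by
  simp [PiLp.inner_apply, Fin.sum_univ_three, mul_comm]

/-- Coordinates of the cross product. [folklore] -/
private theorem cross_apply_zero' (u v : EuclideanSpace ℝ (Fin 3)) :
    cross u v 0 = u 1 * v 2 - u 2 * v 1 := by simp [cross, cross_apply]
/-- Coordinates of the cross product. [folklore] -/
private theorem cross_apply_one' (u v : EuclideanSpace ℝ (Fin 3)) :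
    cross u v 1 = u 2 * v 0 - u 0 * v 2 := by simp [cross, cross_apply]
/-- Coordinates of the cross product. [folklore] -/
private theorem cross_apply_two' (u v : EuclideanSpace ℝ (Fin 3)) :
    cross u v 2 = u 0 * v 1 - u 1 * v 0 := by simp [cross, cross_apply]

/-- Coordinates of `e₃ × y = (−y₁, y₀, 0)`. [folklore] -/
private theorem axisCross_apply (y : EuclideanSpace ℝ (Fin 3)) :
    crossCLM (axis 2) y 0 = -y 1 ∧ crossCLM (axis 2) y 1 = y 0 ∧ crossCLM (axis 2) y 2 = 0 := by
  rw [crossCLM_apply]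
  refine ⟨?_, ?_, ?_⟩ <;> simp [cross, cross_apply, axis]

/-- The gradient field of a smooth function is differentiable. [folklore] -/
private theorem differentiable_gradient_of_smooth {f : EuclideanSpace ℝ (Fin 3) → ℝ}
    (hf : ContDiff ℝ ∞ f) : Differentiable ℝ (gradient f) := by
  have e : gradient f = fun z =>
      (InnerProductSpace.toDual ℝ (EuclideanSpace ℝ (Fin 3))).symm (fderiv ℝ f z) := rfl
  rw [e]
  exact ((InnerProductSpace.toDual ℝ (EuclideanSpace ℝ (Fin 3))).symm.contDiff.comp
    ((contDiff_infty_iff_fderiv.1 hf).2)).differentiable (by simp)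

/-- A radial profile is differentiable as a function on `ℝ³`. [folklore] -/
private theorem differentiableAt_radial' {e : ℝ → ℝ} (he : Differentiable ℝ e)
    (y : EuclideanSpace ℝ (Fin 3)) :
    DifferentiableAt ℝ (fun x : EuclideanSpace ℝ (Fin 3) => e (‖x‖ ^ 2)) y :=
  (he (‖y‖ ^ 2)).comp y ((hasStrictFDerivAt_norm_sq y).hasFDerivAt.differentiableAt)

/-- **Advection of a radially modulated three-lift by any field** — the three product rules
`convect_gradientLift`, `convect_radialLift`, `convect_toroidalLift` assembled (linearity of
`(u·∇)` in the advected field): for differentiable `a, b, c`, smooth `f` and any `u`,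
`(u·∇)(a∇f + bf·y + c y×∇f) = [a·D∇f·u + 2a′⟪y,u⟫∇f] + [b(f u + (Df·u) y) + 2b′⟪y,u⟫f y]`
`+ [c(u×∇f + y×D∇f·u) + 2c′⟪y,u⟫ y×∇f]`. [folklore] -/
theorem convect_threeLift {a b c : ℝ → ℝ} (ha : Differentiable ℝ a) (hb : Differentiable ℝ b)
    (hc : Differentiable ℝ c) {f : EuclideanSpace ℝ (Fin 3) → ℝ} (hf : ContDiff ℝ ∞ f)
    (u : EuclideanSpace ℝ (Fin 3) → EuclideanSpace ℝ (Fin 3)) (y : EuclideanSpace ℝ (Fin 3)) :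
    convect u (fun x : EuclideanSpace ℝ (Fin 3) =>
        a (‖x‖ ^ 2) • gradient f x + b (‖x‖ ^ 2) • (f x • x) +
          c (‖x‖ ^ 2) • cross x (gradient f x)) y =
      (a (‖y‖ ^ 2) • fderiv ℝ (gradient f) y (u y) +
          (deriv a (‖y‖ ^ 2) * (2 * ⟪y, u y⟫)) • gradient f y) +
        (b (‖y‖ ^ 2) • (f y • u y + (fderiv ℝ f y (u y)) • y) +
          (deriv b (‖y‖ ^ 2) * (2 * ⟪y, u y⟫) * f y) • y) +
        (c (‖y‖ ^ 2) • (cross (u y) (gradient f y) + cross y (fderiv ℝ (gradient f) y (u y))) +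
          (deriv c (‖y‖ ^ 2) * (2 * ⟪y, u y⟫)) • cross y (gradient f y)) := by
  have hG : Differentiable ℝ (gradient f) := differentiable_gradient_of_smooth hf
  have hfd : Differentiable ℝ f := hf.differentiable (by simp)
  have hA : DifferentiableAt ℝ (fun x : EuclideanSpace ℝ (Fin 3) => a (‖x‖ ^ 2) • gradient f x) y :=
    (differentiableAt_radial' ha y).smul (hG y)
  have hB : DifferentiableAt ℝ (fun x : EuclideanSpace ℝ (Fin 3) => b (‖x‖ ^ 2) • (f x • x)) y :=
    (differentiableAt_radial' hb y).smul ((hfd y).smul differentiableAt_fun_id)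
  have hC : DifferentiableAt ℝ
      (fun x : EuclideanSpace ℝ (Fin 3) => c (‖x‖ ^ 2) • cross x (gradient f x)) y :=
    (differentiableAt_radial' hc y).smul
      ((convect_toroidalLift.contDiff_crossSelf_differentiable hG) y)
  have hAB : DifferentiableAt ℝ (fun x : EuclideanSpace ℝ (Fin 3) =>
      a (‖x‖ ^ 2) • gradient f x + b (‖x‖ ^ 2) • (f x • x)) y := hA.add hB
  rw [convect_apply, fderiv_fun_add hAB hC, fderiv_fun_add hA hB, _root_.add_apply,
    _root_.add_apply, ← convect_apply u (fun x : EuclideanSpace ℝ (Fin 3) =>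
      a (‖x‖ ^ 2) • gradient f x) y, ← convect_apply u (fun x : EuclideanSpace ℝ (Fin 3) =>
      b (‖x‖ ^ 2) • (f x • x)) y, ← convect_apply u (fun x : EuclideanSpace ℝ (Fin 3) =>
      c (‖x‖ ^ 2) • cross x (gradient f x)) y, convect_gradientLift ha hG,
    convect_radialLift hb hfd, convect_toroidalLift hc hG]

/-! ## §2 The Reynolds stress of the sectoral three-lift wave in closed form -/

section Coordinates

variable (hℓ : ∀ y : EuclideanSpace ℝ (Fin 3), ℓ y = ((y 0 : ℝ) : ℂ) + I * ((y 1 : ℝ) : ℂ))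
include hℓ

/-- **THE FULL SECTORAL REYNOLDS STRESS.** For `n = m + 2 ≥ 2`, `ℓ(y) = y₀ + iy₁`, differentiable
radial profiles `a, b, c`, the three-lift `W = a(‖·‖²)∇Re ℓⁿ + b(‖·‖²) Re ℓⁿ · y + c(‖·‖²)(· × ∇Re ℓⁿ)`
and its quadrature companion `W'` (the same lift of `Im ℓⁿ`):
`(W·∇)W + (W'·∇)W' = s^m · (F_r y₀ − F_φ y₁, F_r y₁ + F_φ y₀, F_z)` with `s = y₀² + y₁²`,
`ρ = y₀² + y₁² + y₂²`, and `F_r, F_φ, F_z` the explicit profile bilinears of the module docstring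
(`n ↦ m + 2`, `n − 1 ↦ m + 1`, `n + 1 ↦ m + 3`). The swirl forcing `F_φ` is carried exactly by the
poloidal × toroidal products `ac′, bc, bc′`. [cite: BullardGellman1954] -/
theorem sectoralThreeLift_selfAdvection_sum {a b c : ℝ → ℝ} (ha : Differentiable ℝ a)
    (hb : Differentiable ℝ b) (hc : Differentiable ℝ c) (m : ℕ) (y : EuclideanSpace ℝ (Fin 3)) :
    convect (fun x => a (‖x‖ ^ (2 : ℕ)) • gradient (fun z => ((ℓ z) ^ (m + 2)).re) x +
          b (‖x‖ ^ (2 : ℕ)) • (((ℓ x) ^ (m + 2)).re • x) +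
          c (‖x‖ ^ (2 : ℕ)) • cross x (gradient (fun z => ((ℓ z) ^ (m + 2)).re) x))
        (fun x => a (‖x‖ ^ (2 : ℕ)) • gradient (fun z => ((ℓ z) ^ (m + 2)).re) x +
          b (‖x‖ ^ (2 : ℕ)) • (((ℓ x) ^ (m + 2)).re • x) +
          c (‖x‖ ^ (2 : ℕ)) • cross x (gradient (fun z => ((ℓ z) ^ (m + 2)).re) x)) y +
      convect (fun x => a (‖x‖ ^ (2 : ℕ)) • gradient (fun z => ((ℓ z) ^ (m + 2)).im) x +
          b (‖x‖ ^ (2 : ℕ)) • (((ℓ x) ^ (m + 2)).im • x) +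
          c (‖x‖ ^ (2 : ℕ)) • cross x (gradient (fun z => ((ℓ z) ^ (m + 2)).im) x))
        (fun x => a (‖x‖ ^ (2 : ℕ)) • gradient (fun z => ((ℓ z) ^ (m + 2)).im) x +
          b (‖x‖ ^ (2 : ℕ)) • (((ℓ x) ^ (m + 2)).im • x) +
          c (‖x‖ ^ (2 : ℕ)) • cross x (gradient (fun z => ((ℓ z) ^ (m + 2)).im) x)) y =
      (((y 0) ^ (2 : ℕ) + (y 1) ^ (2 : ℕ)) ^ m) • WithLp.toLp 2
        ![(2 * ((m : ℝ) + 2) ^ (2 : ℕ) * ((m : ℝ) + 1) * a (‖y‖ ^ (2 : ℕ)) ^ (2 : ℕ) +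
              2 * ((m : ℝ) + 2) ^ (2 : ℕ) * ((y 0) ^ (2 : ℕ) + (y 1) ^ (2 : ℕ)) * a (‖y‖ ^ (2 : ℕ)) * deriv a (‖y‖ ^ (2 : ℕ)) +
              3 * ((m : ℝ) + 2) ^ (2 : ℕ) * ((y 0) ^ (2 : ℕ) + (y 1) ^ (2 : ℕ)) * a (‖y‖ ^ (2 : ℕ)) * b (‖y‖ ^ (2 : ℕ)) +
              2 * ((m : ℝ) + 2) * ((y 0) ^ (2 : ℕ) + (y 1) ^ (2 : ℕ)) ^ (2 : ℕ) * a (‖y‖ ^ (2 : ℕ)) * deriv b (‖y‖ ^ (2 : ℕ)) +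
              ((m : ℝ) + 3) * ((y 0) ^ (2 : ℕ) + (y 1) ^ (2 : ℕ)) ^ (2 : ℕ) * b (‖y‖ ^ (2 : ℕ)) ^ (2 : ℕ) +
              2 * ((m : ℝ) + 2) * ((y 0) ^ (2 : ℕ) + (y 1) ^ (2 : ℕ)) * ((y 0) ^ (2 : ℕ) + (y 1) ^ (2 : ℕ) + (y 2) ^ (2 : ℕ)) *
                deriv a (‖y‖ ^ (2 : ℕ)) * b (‖y‖ ^ (2 : ℕ)) +
              2 * ((y 0) ^ (2 : ℕ) + (y 1) ^ (2 : ℕ)) ^ (2 : ℕ) * ((y 0) ^ (2 : ℕ) + (y 1) ^ (2 : ℕ) + (y 2) ^ (2 : ℕ)) *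
                b (‖y‖ ^ (2 : ℕ)) * deriv b (‖y‖ ^ (2 : ℕ)) +
              ((m : ℝ) + 2) ^ (2 : ℕ) * (2 * ((m : ℝ) + 1) * (y 2) ^ (2 : ℕ) - ((y 0) ^ (2 : ℕ) + (y 1) ^ (2 : ℕ))) *
                c (‖y‖ ^ (2 : ℕ)) ^ (2 : ℕ)) * y 0 -
            ((m : ℝ) + 2) * y 2 * ((y 0) ^ (2 : ℕ) + (y 1) ^ (2 : ℕ)) *
              (2 * ((m : ℝ) + 2) * a (‖y‖ ^ (2 : ℕ)) * deriv c (‖y‖ ^ (2 : ℕ)) +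
                ((m : ℝ) + 3) * b (‖y‖ ^ (2 : ℕ)) * c (‖y‖ ^ (2 : ℕ)) +
                2 * ((y 0) ^ (2 : ℕ) + (y 1) ^ (2 : ℕ) + (y 2) ^ (2 : ℕ)) * b (‖y‖ ^ (2 : ℕ)) * deriv c (‖y‖ ^ (2 : ℕ))) * y 1,
          (2 * ((m : ℝ) + 2) ^ (2 : ℕ) * ((m : ℝ) + 1) * a (‖y‖ ^ (2 : ℕ)) ^ (2 : ℕ) +
              2 * ((m : ℝ) + 2) ^ (2 : ℕ) * ((y 0) ^ (2 : ℕ) + (y 1) ^ (2 : ℕ)) * a (‖y‖ ^ (2 : ℕ)) * deriv a (‖y‖ ^ (2 : ℕ)) +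
              3 * ((m : ℝ) + 2) ^ (2 : ℕ) * ((y 0) ^ (2 : ℕ) + (y 1) ^ (2 : ℕ)) * a (‖y‖ ^ (2 : ℕ)) * b (‖y‖ ^ (2 : ℕ)) +
              2 * ((m : ℝ) + 2) * ((y 0) ^ (2 : ℕ) + (y 1) ^ (2 : ℕ)) ^ (2 : ℕ) * a (‖y‖ ^ (2 : ℕ)) * deriv b (‖y‖ ^ (2 : ℕ)) +
              ((m : ℝ) + 3) * ((y 0) ^ (2 : ℕ) + (y 1) ^ (2 : ℕ)) ^ (2 : ℕ) * b (‖y‖ ^ (2 : ℕ)) ^ (2 : ℕ) +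
              2 * ((m : ℝ) + 2) * ((y 0) ^ (2 : ℕ) + (y 1) ^ (2 : ℕ)) * ((y 0) ^ (2 : ℕ) + (y 1) ^ (2 : ℕ) + (y 2) ^ (2 : ℕ)) *
                deriv a (‖y‖ ^ (2 : ℕ)) * b (‖y‖ ^ (2 : ℕ)) +
              2 * ((y 0) ^ (2 : ℕ) + (y 1) ^ (2 : ℕ)) ^ (2 : ℕ) * ((y 0) ^ (2 : ℕ) + (y 1) ^ (2 : ℕ) + (y 2) ^ (2 : ℕ)) *
                b (‖y‖ ^ (2 : ℕ)) * deriv b (‖y‖ ^ (2 : ℕ)) +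
              ((m : ℝ) + 2) ^ (2 : ℕ) * (2 * ((m : ℝ) + 1) * (y 2) ^ (2 : ℕ) - ((y 0) ^ (2 : ℕ) + (y 1) ^ (2 : ℕ))) *
                c (‖y‖ ^ (2 : ℕ)) ^ (2 : ℕ)) * y 1 +
            ((m : ℝ) + 2) * y 2 * ((y 0) ^ (2 : ℕ) + (y 1) ^ (2 : ℕ)) *
              (2 * ((m : ℝ) + 2) * a (‖y‖ ^ (2 : ℕ)) * deriv c (‖y‖ ^ (2 : ℕ)) +
                ((m : ℝ) + 3) * b (‖y‖ ^ (2 : ℕ)) * c (‖y‖ ^ (2 : ℕ)) +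
                2 * ((y 0) ^ (2 : ℕ) + (y 1) ^ (2 : ℕ) + (y 2) ^ (2 : ℕ)) * b (‖y‖ ^ (2 : ℕ)) * deriv c (‖y‖ ^ (2 : ℕ))) * y 0,
          y 2 * (2 * ((m : ℝ) + 2) ^ (2 : ℕ) * ((y 0) ^ (2 : ℕ) + (y 1) ^ (2 : ℕ)) * a (‖y‖ ^ (2 : ℕ)) * b (‖y‖ ^ (2 : ℕ)) +
              2 * ((m : ℝ) + 2) * ((y 0) ^ (2 : ℕ) + (y 1) ^ (2 : ℕ)) ^ (2 : ℕ) * a (‖y‖ ^ (2 : ℕ)) * deriv b (‖y‖ ^ (2 : ℕ)) +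
              ((m : ℝ) + 3) * ((y 0) ^ (2 : ℕ) + (y 1) ^ (2 : ℕ)) ^ (2 : ℕ) * b (‖y‖ ^ (2 : ℕ)) ^ (2 : ℕ) +
              2 * ((y 0) ^ (2 : ℕ) + (y 1) ^ (2 : ℕ)) ^ (2 : ℕ) * ((y 0) ^ (2 : ℕ) + (y 1) ^ (2 : ℕ) + (y 2) ^ (2 : ℕ)) *
                b (‖y‖ ^ (2 : ℕ)) * deriv b (‖y‖ ^ (2 : ℕ)) -
              2 * ((m : ℝ) + 2) ^ (3 : ℕ) * ((y 0) ^ (2 : ℕ) + (y 1) ^ (2 : ℕ)) * c (‖y‖ ^ (2 : ℕ)) ^ (2 : ℕ))] := by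
  have hφ : ContDiff ℝ ∞ (fun z => ((ℓ z) ^ (m + 2)).re) := contDiff_re_clm_pow ℓ (m + 2)
  have hψ : ContDiff ℝ ∞ (fun z => ((ℓ z) ^ (m + 2)).im) := contDiff_im_clm_pow ℓ (m + 2)
  rw [convect_threeLift ha hb hc hφ, convect_threeLift ha hb hc hψ]
  -- coordinates of the gradients
  obtain ⟨g0, g1, g2⟩ := gradient_re_pow_eq ℓ hℓ (m + 2) y
  obtain ⟨k0, k1, k2⟩ := gradient_im_pow_eq ℓ hℓ (m + 2) y
  simp only [show m + 2 - 1 = m + 1 by omega, Nat.cast_add, Nat.cast_ofNat] at g0 g1 g2 k0 k1 k2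
  -- real and imaginary parts of the Hessian scalars
  have hA : ∀ (M w : ℂ), (((m : ℂ) + 2) * ((m : ℂ) + 1) * M * w).re =
      ((m : ℝ) + 2) * ((m : ℝ) + 1) * (M.re * w.re - M.im * w.im) := fun M w => by
    simp only [Complex.mul_re, Complex.mul_im, Complex.add_re, Complex.add_im,
      Complex.natCast_re, Complex.natCast_im, Complex.re_ofNat, Complex.im_ofNat,
      Complex.one_re, Complex.one_im]
    ring
  have hB : ∀ (M w : ℂ), (((m : ℂ) + 2) * ((m : ℂ) + 1) * M * w).im =
      ((m : ℝ) + 2) * ((m : ℝ) + 1) * (M.re * w.im + M.im * w.re) := fun M w => by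
    simp only [Complex.mul_re, Complex.mul_im, Complex.add_re, Complex.add_im,
      Complex.natCast_re, Complex.natCast_im, Complex.re_ofNat, Complex.im_ofNat,
      Complex.one_re, Complex.one_im]
    ring
  have hre : ∀ v : EuclideanSpace ℝ (Fin 3), (ℓ v).re = v 0 := fun v => by rw [hℓ v]; simp
  have him : ∀ v : EuclideanSpace ℝ (Fin 3), (ℓ v).im = v 1 := fun v => by rw [hℓ v]; simp
  -- the Hessians along an arbitrary direction, in coordinates
  have A0 : ∀ v : EuclideanSpace ℝ (Fin 3), fderiv ℝ (gradient fun z => ((ℓ z) ^ (m + 2)).re) y v 0 =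
      ((m : ℝ) + 2) * ((m : ℝ) + 1) * (((ℓ y) ^ m).re * v 0 - ((ℓ y) ^ m).im * v 1) := fun v => by
    obtain ⟨a0, -, -⟩ := fderiv_gradient_re_pow_eq ℓ hℓ (m + 2) y v
    simp only [show m + 2 - 1 = m + 1 by omega, show m + 1 - 1 = m by omega, Nat.cast_add,
      Nat.cast_one, Nat.cast_ofNat] at a0
    rw [a0, hA, hre, him]
  have A1 : ∀ v : EuclideanSpace ℝ (Fin 3), fderiv ℝ (gradient fun z => ((ℓ z) ^ (m + 2)).re) y v 1 =
      -(((m : ℝ) + 2) * ((m : ℝ) + 1) * (((ℓ y) ^ m).re * v 1 + ((ℓ y) ^ m).im * v 0)) :=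
    fun v => by
    obtain ⟨-, a1, -⟩ := fderiv_gradient_re_pow_eq ℓ hℓ (m + 2) y v
    simp only [show m + 2 - 1 = m + 1 by omega, show m + 1 - 1 = m by omega, Nat.cast_add,
      Nat.cast_one, Nat.cast_ofNat] at a1
    rw [a1, hB, hre, him]
  have A2 : ∀ v : EuclideanSpace ℝ (Fin 3),
      fderiv ℝ (gradient fun z => ((ℓ z) ^ (m + 2)).re) y v 2 = 0 := fun v =>
    (fderiv_gradient_re_pow_eq ℓ hℓ (m + 2) y v).2.2
  have B0 : ∀ v : EuclideanSpace ℝ (Fin 3), fderiv ℝ (gradient fun z => ((ℓ z) ^ (m + 2)).im) y v 0 =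
      ((m : ℝ) + 2) * ((m : ℝ) + 1) * (((ℓ y) ^ m).re * v 1 + ((ℓ y) ^ m).im * v 0) := fun v => by
    obtain ⟨b0, -, -⟩ := fderiv_gradient_im_pow_eq ℓ hℓ (m + 2) y v
    simp only [show m + 2 - 1 = m + 1 by omega, show m + 1 - 1 = m by omega, Nat.cast_add,
      Nat.cast_one, Nat.cast_ofNat] at b0
    rw [b0, hB, hre, him]
  have B1 : ∀ v : EuclideanSpace ℝ (Fin 3), fderiv ℝ (gradient fun z => ((ℓ z) ^ (m + 2)).im) y v 1 =
      ((m : ℝ) + 2) * ((m : ℝ) + 1) * (((ℓ y) ^ m).re * v 0 - ((ℓ y) ^ m).im * v 1) := fun v => by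
    obtain ⟨-, b1, -⟩ := fderiv_gradient_im_pow_eq ℓ hℓ (m + 2) y v
    simp only [show m + 2 - 1 = m + 1 by omega, show m + 1 - 1 = m by omega, Nat.cast_add,
      Nat.cast_one, Nat.cast_ofNat] at b1
    rw [b1, hA, hre, him]
  have B2 : ∀ v : EuclideanSpace ℝ (Fin 3),
      fderiv ℝ (gradient fun z => ((ℓ z) ^ (m + 2)).im) y v 2 = 0 := fun v =>
    (fderiv_gradient_im_pow_eq ℓ hℓ (m + 2) y v).2.2
  -- the first derivatives as inner products with the gradients
  have dφ : ∀ w : EuclideanSpace ℝ (Fin 3), fderiv ℝ (fun z => ((ℓ z) ^ (m + 2)).re) y w =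
      ⟪gradient (fun z => ((ℓ z) ^ (m + 2)).re) y, w⟫ := fun w =>
    (inner_gradient_left (f := fun z => ((ℓ z) ^ (m + 2)).re) (x := y) (y := w)).symm
  have dψ : ∀ w : EuclideanSpace ℝ (Fin 3), fderiv ℝ (fun z => ((ℓ z) ^ (m + 2)).im) y w =
      ⟪gradient (fun z => ((ℓ z) ^ (m + 2)).im) y, w⟫ := fun w =>
    (inner_gradient_left (f := fun z => ((ℓ z) ^ (m + 2)).im) (x := y) (y := w)).symm
  -- the powers: `ℓ^{m+2} = ℓ² · ℓ^m`, `ℓ^{m+1} = ℓ · ℓ^m`, `|ℓ^m|² = s^m`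
  have hL : (ℓ y) ^ (m + 1) = ℓ y * (ℓ y) ^ m := by ring
  have hLre : ((ℓ y) ^ (m + 1)).re = y 0 * ((ℓ y) ^ m).re - y 1 * ((ℓ y) ^ m).im := by
    rw [hL, Complex.mul_re, hℓ y]; simp
  have hLim : ((ℓ y) ^ (m + 1)).im = y 0 * ((ℓ y) ^ m).im + y 1 * ((ℓ y) ^ m).re := by
    rw [hL, Complex.mul_im, hℓ y]; simp
  have hL2 : (ℓ y) ^ (m + 2) = ℓ y * (ℓ y) ^ (m + 1) := by ring
  have hFre : ((ℓ y) ^ (m + 2)).re =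
      y 0 * (y 0 * ((ℓ y) ^ m).re - y 1 * ((ℓ y) ^ m).im) -
        y 1 * (y 0 * ((ℓ y) ^ m).im + y 1 * ((ℓ y) ^ m).re) := by
    rw [hL2, Complex.mul_re, hLre, hLim, hℓ y]; simp
  have hFim : ((ℓ y) ^ (m + 2)).im =
      y 0 * (y 0 * ((ℓ y) ^ m).im + y 1 * ((ℓ y) ^ m).re) +
        y 1 * (y 0 * ((ℓ y) ^ m).re - y 1 * ((ℓ y) ^ m).im) := by
    rw [hL2, Complex.mul_im, hLre, hLim, hℓ y]; simp
  have hs : ((y 0) ^ 2 + (y 1) ^ 2) ^ m = ((ℓ y) ^ m).re ^ 2 + ((ℓ y) ^ m).im ^ 2 := by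
    have h1 : Complex.normSq ((ℓ y) ^ m) = ((y 0) ^ 2 + (y 1) ^ 2) ^ m := by
      rw [map_pow, hℓ y, Complex.normSq_apply]; simp; ring
    rw [← h1, Complex.normSq_apply]; ring
  -- assemble coordinate by coordinate (polynomial identities in y₀, y₁, y₂, Re ℓ^m, Im ℓ^m and
  -- the six profile values)
  rw [hs]
  apply PiLp.ext
  intro i
  fin_cases i <;>
    simp only [Fin.zero_eta, Fin.mk_one, Fin.reduceFinMk, Fin.isValue, PiLp.add_apply,
      PiLp.smul_apply, smul_eq_mul, inner_fin3, dφ, dψ,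
      cross_apply_zero', cross_apply_one', cross_apply_two',
      Matrix.cons_val_zero, Matrix.cons_val_one, Matrix.cons_val_two, Matrix.head_cons,
      Matrix.tail_cons, g0, g1, g2, k0, k1, k2, A0, A1, A2, B0, B1, B2, hLre, hLim, hFre,
      hFim] <;>
    ring

/-! ## §3 The swirl-forcing letter and the poloidal no-swirl corollary -/

/-- **THE SWIRL-FORCING LETTER** (streak source of the SSP dictionary): the azimuthal component of
the sectoral Reynolds stress is
`⟪(W·∇)W + (W'·∇)W', e₃ × y⟫ = s^m · n z s² · (2n·a c′ + (n+1)·b c + 2‖y‖²·b c′)` —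
bilinear in (poloidal member) × (toroidal member), odd in `z = y₂`. [cite: BullardGellman1954] -/
theorem sectoralThreeLift_swirlForcing {a b c : ℝ → ℝ} (ha : Differentiable ℝ a)
    (hb : Differentiable ℝ b) (hc : Differentiable ℝ c) (m : ℕ) (y : EuclideanSpace ℝ (Fin 3)) :
    ⟪convect (fun x => a (‖x‖ ^ (2 : ℕ)) • gradient (fun z => ((ℓ z) ^ (m + 2)).re) x +
          b (‖x‖ ^ (2 : ℕ)) • (((ℓ x) ^ (m + 2)).re • x) +
          c (‖x‖ ^ (2 : ℕ)) • cross x (gradient (fun z => ((ℓ z) ^ (m + 2)).re) x))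
        (fun x => a (‖x‖ ^ (2 : ℕ)) • gradient (fun z => ((ℓ z) ^ (m + 2)).re) x +
          b (‖x‖ ^ (2 : ℕ)) • (((ℓ x) ^ (m + 2)).re • x) +
          c (‖x‖ ^ (2 : ℕ)) • cross x (gradient (fun z => ((ℓ z) ^ (m + 2)).re) x)) y +
      convect (fun x => a (‖x‖ ^ (2 : ℕ)) • gradient (fun z => ((ℓ z) ^ (m + 2)).im) x +
          b (‖x‖ ^ (2 : ℕ)) • (((ℓ x) ^ (m + 2)).im • x) +
          c (‖x‖ ^ (2 : ℕ)) • cross x (gradient (fun z => ((ℓ z) ^ (m + 2)).im) x))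
        (fun x => a (‖x‖ ^ (2 : ℕ)) • gradient (fun z => ((ℓ z) ^ (m + 2)).im) x +
          b (‖x‖ ^ (2 : ℕ)) • (((ℓ x) ^ (m + 2)).im • x) +
          c (‖x‖ ^ (2 : ℕ)) • cross x (gradient (fun z => ((ℓ z) ^ (m + 2)).im) x)) y,
      crossCLM (axis 2) y⟫ =
      ((y 0) ^ (2 : ℕ) + (y 1) ^ (2 : ℕ)) ^ m * (((m : ℝ) + 2) * y 2 *
        ((y 0) ^ (2 : ℕ) + (y 1) ^ (2 : ℕ)) ^ (2 : ℕ) *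
        (2 * ((m : ℝ) + 2) * a (‖y‖ ^ (2 : ℕ)) * deriv c (‖y‖ ^ (2 : ℕ)) +
          ((m : ℝ) + 3) * b (‖y‖ ^ (2 : ℕ)) * c (‖y‖ ^ (2 : ℕ)) +
          2 * ((y 0) ^ (2 : ℕ) + (y 1) ^ (2 : ℕ) + (y 2) ^ (2 : ℕ)) * b (‖y‖ ^ (2 : ℕ)) *
            deriv c (‖y‖ ^ (2 : ℕ)))) := by
  obtain ⟨e0, e1, e2⟩ := axisCross_apply y
  rw [sectoralThreeLift_selfAdvection_sum ℓ hℓ ha hb hc m y, inner_fin3]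
  simp only [PiLp.smul_apply, smul_eq_mul, Matrix.cons_val_zero, Matrix.cons_val_one,
    Matrix.cons_val_two, Matrix.head_cons, Matrix.tail_cons, e0, e1, e2]
  ring

/-- **A pure POLOIDAL sectoral wave forces no swirl**: for `W = a∇Re ℓⁿ + b Re ℓⁿ · y` (no
toroidal member) the azimuthal component of `(W·∇)W + (W'·∇)W'` vanishes identically — in the
SSP dictionary, streaks are fed only by poloidal × toroidal wave products. [cite: BullardGellman1954] -/
theorem sectoralPoloidal_selfAdvection_swirl_free {a b : ℝ → ℝ} (ha : Differentiable ℝ a)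
    (hb : Differentiable ℝ b) (m : ℕ) (y : EuclideanSpace ℝ (Fin 3)) :
    ⟪convect (fun x => a (‖x‖ ^ (2 : ℕ)) • gradient (fun z => ((ℓ z) ^ (m + 2)).re) x +
          b (‖x‖ ^ (2 : ℕ)) • (((ℓ x) ^ (m + 2)).re • x))
        (fun x => a (‖x‖ ^ (2 : ℕ)) • gradient (fun z => ((ℓ z) ^ (m + 2)).re) x +
          b (‖x‖ ^ (2 : ℕ)) • (((ℓ x) ^ (m + 2)).re • x)) y +
      convect (fun x => a (‖x‖ ^ (2 : ℕ)) • gradient (fun z => ((ℓ z) ^ (m + 2)).im) x +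
          b (‖x‖ ^ (2 : ℕ)) • (((ℓ x) ^ (m + 2)).im • x))
        (fun x => a (‖x‖ ^ (2 : ℕ)) • gradient (fun z => ((ℓ z) ^ (m + 2)).im) x +
          b (‖x‖ ^ (2 : ℕ)) • (((ℓ x) ^ (m + 2)).im • x)) y,
      crossCLM (axis 2) y⟫ = 0 := by
  have eφ : (fun x : EuclideanSpace ℝ (Fin 3) =>
      a (‖x‖ ^ (2 : ℕ)) • gradient (fun z => ((ℓ z) ^ (m + 2)).re) x +
        b (‖x‖ ^ (2 : ℕ)) • (((ℓ x) ^ (m + 2)).re • x)) =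
      fun x => a (‖x‖ ^ (2 : ℕ)) • gradient (fun z => ((ℓ z) ^ (m + 2)).re) x +
        b (‖x‖ ^ (2 : ℕ)) • (((ℓ x) ^ (m + 2)).re • x) +
        (fun _ : ℝ => (0 : ℝ)) (‖x‖ ^ (2 : ℕ)) •
          cross x (gradient (fun z => ((ℓ z) ^ (m + 2)).re) x) := by
    funext x; simp
  have eψ : (fun x : EuclideanSpace ℝ (Fin 3) =>
      a (‖x‖ ^ (2 : ℕ)) • gradient (fun z => ((ℓ z) ^ (m + 2)).im) x +
        b (‖x‖ ^ (2 : ℕ)) • (((ℓ x) ^ (m + 2)).im • x)) =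
      fun x => a (‖x‖ ^ (2 : ℕ)) • gradient (fun z => ((ℓ z) ^ (m + 2)).im) x +
        b (‖x‖ ^ (2 : ℕ)) • (((ℓ x) ^ (m + 2)).im • x) +
        (fun _ : ℝ => (0 : ℝ)) (‖x‖ ^ (2 : ℕ)) •
          cross x (gradient (fun z => ((ℓ z) ^ (m + 2)).im) x) := by
    funext x; simp
  rw [eφ, eψ, sectoralThreeLift_swirlForcing ℓ hℓ ha hb (differentiable_const (0 : ℝ)) m y]
  simp

end Coordinates

end Summit.NavierStokesRegularity.AngularGalerkinLadderSectoralReynoldsStressFull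

end
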